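import Summits.AtomisticToContinuum.FouriersLaw.Theses.GriffithsLimitExchange

/-!
# Birth skeleton (`Lines/birth.lean`) for crux `ResponseIdentity` (stmt-AtomisticToContinuum-13202)

Route `GriffithsLimitExchange` (sub-problem `FouriersLaw`), crux r6 `ResponseIdentity` = the KDN RESPONSE
IDENTITY IN TRANSMISSION FORM: for `P = pinnedChain ω₂ lam β γ` (all four `> 0`), ASSUMING weak-NESS uniqueness,
for every steady-state family `μ`, every `T > 0` and every `N`,
`totalCurrent(μ N (T+δ/2) (T-δ/2))/δ → (N-1)·γ·E_N` as `δ → 0`, `δ ≠ 0`, where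
`E_N = (γ/T²)∫_{u>0} Kt_N(u)`, `Kt_N(u) = ∫ (p_0²-T)·P_{u⁺}(p_{N-1}²-T) dμ_T` (CENTRED transmission kernel of
the equilibrium `N`-chain: constructed kernels `P.transitionKernel N T T u⁺`, Gibbs state `P.gibbsMeasure N T`;
`N = 0`: kernel `0` by the route's convention).

## The line: REDUCTION TO THE CROSS-FORM BOUNDARY KUBO IDENTITY (two stubs)

* `stub_crossKubo` — the fixed-`N` CROSS-FORM boundary Kubo limit for the `(N+1)`-site chain:
  `totalCurrent(μ (N+1) (T+δ/2) (T-δ/2))/δ → N·(γ²/T²)·∫_{t>0} C_N(t)`,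
  `C_N(t) = ∫ p_0²·(K_t p_N²) dμ_T - (∫ p_0² dμ_T)(∫ K_t p_N² dμ_T)` (UNCENTRED covariance form).
  This is, verbatim, clause 2 of the sibling crux `PhononMeanFreePath.BoundaryKubo`
  (stmt-AtomisticToContinuum-11812), which is LANDED: `Theorems/PhononMeanFreePathBoundaryKubo.lean`,
  `boundaryKubo_proof` (line `gibbs-ttcf`: Gibbs-tested TTCF identity, locally uniform Harris, energy balance,
  equilibrium sum rule). A stub prover discharges it by
  `fun … hT N => (boundaryKubo_proof … hT N).2` (import that Theorems file; nothing else).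
* `stub_kernelCentring` — KERNEL CENTRING at equilibrium, pointwise in `t` (kernel at `t⁺`):
  `∫ p_0²·K_t p_N² dμ_T - (∫ p_0² dμ_T)(∫ K_t p_N² dμ_T) = ∫ (p_0²-T)·K_t(p_N²-T) dμ_T` for the `(N+1)`-site
  chain. Expanding, the two sides differ by `(∫ p_0² dμ_T - T)·(∫ K_t p_N² dμ_T - T)`, so EQUIPARTITION
  `∫ p_0² dμ_T = T` suffices, given the integrability bookkeeping (`y ↦ y_N²` integrable under EVERY `K_t(z,·)`
  by the exponential moments along the constructed kernels; `p_0²·K_t p_N²`, `K_t p_N²` in `L¹(μ_T)` by Gibbs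
  invariance + Cauchy–Schwarz; Markov kernels). Size M — AND ALREADY LANDED, verbatim:
  `Theorems/PhononMeanFreePathIncoherentBoundedFixedN.lean`, `IncoherentBounded.CN_eq_kinCorr`
  (discharge: `fun … hω hl hβ hγ T hT N t => IncoherentBounded.CN_eq_kinCorr hω hl.le hβ hγ hT N t`).
* `ResponseIdentity_of` — the composition, kernel-checked here: `N = 0` (empty chain: `totalCurrent = 0`,
  `E_0 = 0`, both sides `0`); `N = M+1`: the crux's `Kt_{M+1}(u)` is the centred kernel with indices
  `⟨0,_⟩ = 0`, `⟨M+1-1,_⟩ = Fin.last M`, so by `stub_kernelCentring` it equals `C_M(u)` pointwise, and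
  `((M+1)-1)·γ·(γ/T²)·∫C_M = M·(γ²/T²)·∫C_M` is the value delivered by `stub_crossKubo`.

Hardest stub: none — BOTH stubs are landed theorems (checked in the planner's scratch: each stub statement is
closed by the one-line term above, axioms propext/Classical.choice/Quot.sound). `stub_crossKubo` WAS the L-sized
content (fixed-`N` linear response at equilibrium for the hypoelliptic Langevin chain, CEHR 2018 Thm 2.13
re-threaded with temperature-uniform Harris constants, line `gibbs-ttcf` of crux 11812). So the crux
`ResponseIdentity` is PROVABLE NOW: a prover re-files this composition in
`Theorems/GriffithsLimitExchangeResponseIdentity.lean` with the two imports and the two one-liners.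

## Disproof used
No `Cruxes/ResponseIdentity/Disproof.lean` exists for this crux (`ledger crux ls`: no workfiles). The sibling's
negative files apply verbatim to `stub_crossKubo` and are honoured: `BoundaryKubo.Negative.LoadBearing`
`limitClause_false_without_steady` / `limitClause_false_without_T_pos` (the steady family and `T > 0` are
load-bearing — both hypotheses are carried by `stub_crossKubo` and by the crux), `body_vacuous_gamma_zero`
(`γ > 0` enters only through uniqueness/mixing), §1 `N = 0` harmless (one site: value `0`; here additionally the
EMPTY chain `N = 0` of the crux is settled in `ResponseIdentity_of` itself). `ledger negatives --problem
AtomisticToContinuum`: no refuted statement concerns fixed-`N` Kubo identities; no landed Negative lemma refutes an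
instance of either stub (stub 1 is proved; stub 2 is an identity between finite Gibbs integrals).
-/

noncomputable section

open MeasureTheory Filter Topology Set
open scoped NNReal

namespace Summit.AtomisticToContinuum.FouriersLaw.Cruxes.ResponseIdentity.Birth

open Literature.MathematicalPhysics.KineticTheory.HeatConduction
open Summit.AtomisticToContinuum.FouriersLaw.Theses.GriffithsLimitExchange (ResponseIdentity)

/-! ### The registered stubs (`sorry` lives ONLY here) -/

/-- STUB 1 `stub_crossKubo` (size: landed) — the CROSS-FORM BOUNDARY KUBO LIMIT for the `(N+1)`-site chain
under weak-NESS uniqueness, along any steady-state family: `totalCurrent(μ (N+1) (T+δ/2) (T-δ/2))/δ →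
N·(γ²/T²)·∫_{t>0} C_N(t)` with `C_N(t) = μ_T(p_0²·K_t p_N²) - μ_T(p_0²)·μ_T(K_t p_N²)`. Verbatim clause 2 of
`PhononMeanFreePath.BoundaryKubo` (stmt-AtomisticToContinuum-11812), proved in
`Theorems/PhononMeanFreePathBoundaryKubo.lean` (`boundaryKubo_proof`). [cite: KunduDharNarayan2009]
[cite: CuneoEckmannHairerReyBellet2018, Thm 2.13] -/
theorem stub_crossKubo :
    ∀ ω₂ lam β γ : ℝ, 0 < ω₂ → 0 < lam → 0 < β → 0 < γ →
      (∀ (N : ℕ) (T_L T_R : ℝ), 0 < T_L → 0 < T_R → ∀ μ ν : Measure (PhaseSpace N),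
          (pinnedChain ω₂ lam β γ).IsSteadyState N T_L T_R μ →
            (pinnedChain ω₂ lam β γ).IsSteadyState N T_L T_R ν → μ = ν) →
        ∀ μ : (N : ℕ) → ℝ → ℝ → Measure (PhaseSpace N),
          (∀ (N : ℕ) (T_L T_R : ℝ), 0 < T_L → 0 < T_R →
              (pinnedChain ω₂ lam β γ).IsSteadyState N T_L T_R (μ N T_L T_R)) →
            ∀ T : ℝ, 0 < T → ∀ N : ℕ,
              Tendsto (fun δ : ℝ =>
                  (pinnedChain ω₂ lam β γ).totalCurrent (μ (N + 1) (T + δ / 2) (T - δ / 2)) / δ)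
                (𝓝[≠] 0)
                (𝓝 ((N : ℝ) * (γ ^ 2 / T ^ 2) * ∫ t in Ioi (0 : ℝ),
                  ((∫ z, (z.2 0) ^ 2 * (∫ y, (y.2 (Fin.last N)) ^ 2
                      ∂((pinnedChain ω₂ lam β γ).transitionKernel (N + 1) T T t.toNNReal z))
                      ∂((pinnedChain ω₂ lam β γ).gibbsMeasure (N + 1) T)) -
                    (∫ z, (z.2 0) ^ 2 ∂((pinnedChain ω₂ lam β γ).gibbsMeasure (N + 1) T)) *
                      (∫ z, (∫ y, (y.2 (Fin.last N)) ^ 2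
                        ∂((pinnedChain ω₂ lam β γ).transitionKernel (N + 1) T T t.toNNReal z))
                        ∂((pinnedChain ω₂ lam β γ).gibbsMeasure (N + 1) T))))) := by
  sorry

/-- STUB 2 `stub_kernelCentring` (size M; landed) — KERNEL CENTRING AT EQUILIBRIUM: for the `(N+1)`-site chain at
temperature `T > 0` and every real `t` (kernel at `t⁺`), the UNCENTRED cross covariance equals the CENTRED
transmission kernel, `∫ p_0²·K_t p_N² dμ_T - (∫ p_0² dμ_T)(∫ K_t p_N² dμ_T) = ∫ (p_0²-T)·K_t(p_N²-T) dμ_T`: the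
difference of the two sides is `(μ_T(p_0²) - T)(μ_T(K_t p_N²) - T)`, killed by equipartition `μ_T(p_0²) = T`;
needs `K_t(p_N²-T)(z) = K_t p_N²(z) - T` for every `z` (Markov kernel + `p_N²` integrable under each `K_t(z,·)`:
exponential moments along the constructed kernels) and `μ_T`-integrability of `p_0²·K_t p_N²`, `K_t p_N²` (Gibbs
invariance, Cauchy–Schwarz). Verbatim `IncoherentBounded.CN_eq_kinCorr`
(`Theorems/PhononMeanFreePathIncoherentBoundedFixedN.lean`). [folklore] -/
theorem stub_kernelCentring :
    ∀ ω₂ lam β γ : ℝ, 0 < ω₂ → 0 < lam → 0 < β → 0 < γ → ∀ T : ℝ, 0 < T → ∀ (N : ℕ) (t : ℝ),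
      (∫ z, (z.2 0) ^ 2 * (∫ y, (y.2 (Fin.last N)) ^ 2
          ∂((pinnedChain ω₂ lam β γ).transitionKernel (N + 1) T T t.toNNReal z))
          ∂((pinnedChain ω₂ lam β γ).gibbsMeasure (N + 1) T)) -
        (∫ z, (z.2 0) ^ 2 ∂((pinnedChain ω₂ lam β γ).gibbsMeasure (N + 1) T)) *
          (∫ z, (∫ y, (y.2 (Fin.last N)) ^ 2
            ∂((pinnedChain ω₂ lam β γ).transitionKernel (N + 1) T T t.toNNReal z))
            ∂((pinnedChain ω₂ lam β γ).gibbsMeasure (N + 1) T)) =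
      ∫ z, ((z.2 0) ^ 2 - T) * (∫ y, ((y.2 (Fin.last N)) ^ 2 - T)
          ∂((pinnedChain ω₂ lam β γ).transitionKernel (N + 1) T T t.toNNReal z))
          ∂((pinnedChain ω₂ lam β γ).gibbsMeasure (N + 1) T) := by
  sorry

/-! ### By-name statements of the registered stubs

The skeleton audit (`#h21_check_skeleton`) wants the hypotheses of the crux-concluding theorem to be the declared
stubs BY NAME; `Registered.stub_x` is DEFINITIONALLY the statement of the sorried `theorem stub_x` (`type_of%`), so
`ResponseIdentity_of : Registered.stub_crossKubo → Registered.stub_kernelCentring → ResponseIdentity` is literally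
"stub signatures → crux", and the `example` at the end type-checks `ResponseIdentity_of stub_crossKubo
stub_kernelCentring : ResponseIdentity`. -/

namespace Registered

/-- Statement of registered stub 1 (`stub_crossKubo`), by name. -/
def stub_crossKubo : Prop := type_of% Birth.stub_crossKubo

/-- Statement of registered stub 2 (`stub_kernelCentring`), by name. -/
def stub_kernelCentring : Prop := type_of% Birth.stub_kernelCentring

end Registered

/-! ### The composition (kernel-checked, no `sorry`): the two stubs give the crux BY NAME -/

/-- `stub_crossKubo → stub_kernelCentring → ResponseIdentity`: split `N = 0` (empty chain, both sides `0`)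
/ `N = M + 1` (identify the crux's centred kernel `Kt_{M+1}` with `C_M` pointwise by centring, and the value
`((M+1)-1)·γ·(γ/T²)·∫C_M` with `M·(γ²/T²)·∫C_M`). [folklore] -/
theorem ResponseIdentity_of (h1 : Registered.stub_crossKubo) (h2 : Registered.stub_kernelCentring) :
    ResponseIdentity := by
  intro ω₂ lam β γ hω hl hβ hγ huniq μ hμ T hT
  dsimp only
  intro N
  cases N with
  | zero =>
    -- empty chain: no bond, no current; the kernel is `0` by convention, so `E_0 = 0`
    have h0 : (fun δ : ℝ => (pinnedChain ω₂ lam β γ).totalCurrent (μ 0 (T + δ / 2) (T - δ / 2)) / δ) =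
        fun _ => 0 := by
      funext δ
      rw [OscillatorChain.totalCurrent_zero, zero_div]
    rw [h0]
    simp
  | succ M =>
    have key := h1 ω₂ lam β γ hω hl hβ hγ huniq μ hμ T hT M
    -- the crux's centred kernel at `M + 1` sites is the uncentred cross covariance `C_M`, pointwise
    have hKt : ∀ u : ℝ,
        (if h : 0 < M + 1 then
            ∫ z, ((z.2 ⟨0, h⟩) ^ 2 - T) * (∫ y, ((y.2 ⟨M + 1 - 1, by omega⟩) ^ 2 - T)
              ∂((pinnedChain ω₂ lam β γ).transitionKernel (M + 1) T T u.toNNReal z))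
              ∂((pinnedChain ω₂ lam β γ).gibbsMeasure (M + 1) T)
          else 0) =
          (∫ z, (z.2 0) ^ 2 * (∫ y, (y.2 (Fin.last M)) ^ 2
              ∂((pinnedChain ω₂ lam β γ).transitionKernel (M + 1) T T u.toNNReal z))
              ∂((pinnedChain ω₂ lam β γ).gibbsMeasure (M + 1) T)) -
            (∫ z, (z.2 0) ^ 2 ∂((pinnedChain ω₂ lam β γ).gibbsMeasure (M + 1) T)) *
              (∫ z, (∫ y, (y.2 (Fin.last M)) ^ 2
                ∂((pinnedChain ω₂ lam β γ).transitionKernel (M + 1) T T u.toNNReal z))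
                ∂((pinnedChain ω₂ lam β γ).gibbsMeasure (M + 1) T)) := by
      intro u
      rw [dif_pos (Nat.succ_pos M)]
      exact (h2 ω₂ lam β γ hω hl hβ hγ T hT M u).symm
    simp only [hKt]
    convert key using 2
    push_cast
    ring

/-- Type-check (not a declaration): the sorried stubs are literally the antecedents of `ResponseIdentity_of`
(conditional on the stubs; an `example`, so it adds nothing to the environment). -/
example : ResponseIdentity := ResponseIdentity_of stub_crossKubo stub_kernelCentring

end Summit.AtomisticToContinuum.FouriersLaw.Cruxes.ResponseIdentity.Birth

end
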